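import Mathlib

/-!
# BSD rank-≤1 residual cell, class X11b @ 3 — the group-theoretic step of the S-CLASS certificate (analytic road, (C3b))

HONEST FRAMING (cell `b2b-bsdres-*`): this file books NOTHING; it is the elementary finite-group inference used by the analytic-road
records (x11b GEN 13, `HOME/b2b-bsdres-x11b/g13/ANALYTIC-ROAD.md` §1 (C3)): `G` = the class group `Cl(A)` (finite abelian), `H` = the
subgroup generated by the classes of the primes of `A` above the descent set `S` (so `Cl_S(A) = G ⧸ H`), `p = 3`. The certificate
exhibits `y ∈ H` (the class of an `S`-supported ideal) with `y ^ (p ^ v) = 1` (an EXACT principal-ideal identity) and `y ^ (p ^ (v−1)) ≠ 1`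
(a cubic-residue-character obstruction), while `(C1)+(C2)` give `p ^ (v+1) ∤ #G` (`v = v_p(h)`); CONCLUSION: `p ∤ #(G ⧸ H)`, i.e.
`Cl_S(A)` has no `p`-torsion, so `A(S,p) = O_{A,S}^×/p` and the GRH descent's ambient space is complete. Pure group theory
(Lagrange); X11 ∧ r = 1 ∧ p = 3 stays CONSTRUCTION-SHAPED (R6.2); not "finishing BSD".
-/

namespace Summit.BirchSwinnertonDyer.Rank1Residual.X11b.SClassCertificate

/-- If a subgroup `H` of a finite group contains an element of order `p ^ v` and `p ^ (v+1) ∤ #G`, then `p ∤ #(G ⧸ H)`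
(Lagrange twice: `p ^ v ∣ #H` and `#G = #H · #(G ⧸ H)`). -/
theorem not_dvd_card_quotient_of_orderOf_eq {G : Type*} [CommGroup G] [Finite G] {p v : ℕ} (H : Subgroup G) {y : G}
    (hyH : y ∈ H) (hord : orderOf y = p ^ v) (hG : ¬ p ^ (v + 1) ∣ Nat.card G) : ¬ p ∣ Nat.card (G ⧸ H) := by
  intro hdiv
  have h1 : p ^ v ∣ Nat.card H := by
    have : orderOf (⟨y, hyH⟩ : H) = p ^ v := by rw [Subgroup.orderOf_mk, hord]
    rw [← this]; exact orderOf_dvd_natCard _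
  have h2 : Nat.card G = Nat.card H * Nat.card (G ⧸ H) := by
    rw [mul_comm]; exact (Subgroup.card_eq_card_quotient_mul_card_subgroup H)
  apply hG
  rw [h2, pow_succ]
  exact mul_dvd_mul h1 hdiv

/-- The order of the witness from the two certificate facts: `y ^ (p ^ v) = 1` (exact principal-ideal identity for the `(p^v)`-th power)
and `y ^ (p ^ (v-1)) ≠ 1` (the generator of the `(p^{v-1})`-th power would be a unit times a `p`-th power — excluded by residue characters),
`v ≥ 1`. -/
theorem orderOf_eq_prime_pow_of_certificate {G : Type*} [Monoid G] {p : ℕ} [hp : Fact p.Prime] {y : G} {v : ℕ} (hv : 1 ≤ v)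
    (hpow : y ^ (p ^ v) = 1) (hnot : y ^ (p ^ (v - 1)) ≠ 1) : orderOf y = p ^ v := by
  obtain ⟨w, rfl⟩ : ∃ w, v = w + 1 := ⟨v - 1, by omega⟩
  simp only [Nat.add_sub_cancel] at hnot
  exact orderOf_eq_prime_pow hnot hpow

/-- No `p`-torsion in the quotient: if `p ∤ #(G ⧸ H)` then every `z : G ⧸ H` with `z ^ p = 1` is trivial. -/
theorem quotient_pow_prime_eq_one_imp {G : Type*} [CommGroup G] [Finite G] {p : ℕ} (hp : p.Prime) (H : Subgroup G)
    (hnd : ¬ p ∣ Nat.card (G ⧸ H)) {z : G ⧸ H} (hz : z ^ p = 1) : z = 1 := by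
  have h1 : orderOf z ∣ p := orderOf_dvd_of_pow_eq_one hz
  have h2 : orderOf z ∣ Nat.card (G ⧸ H) := orderOf_dvd_natCard z
  rcases (Nat.dvd_prime hp).mp h1 with h | h
  · exact orderOf_eq_one_iff.mp h
  · exact absurd (h ▸ h2) hnd

/-- The S-class certificate, assembled: witness `y ∈ H` with `y^(p^v) = 1`, `y^(p^(v-1)) ≠ 1`, `v ≥ 1`, and `p^(v+1) ∤ #G`
⇒ the quotient `G ⧸ H` (`= Cl_S(A)`) has no element of order `p`. -/
theorem sclass_certificate {G : Type*} [CommGroup G] [Finite G] {p v : ℕ} [hp : Fact p.Prime] (H : Subgroup G) {y : G}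
    (hyH : y ∈ H) (hv : 1 ≤ v) (hpow : y ^ (p ^ v) = 1) (hnot : y ^ (p ^ (v - 1)) ≠ 1) (hG : ¬ p ^ (v + 1) ∣ Nat.card G)
    {z : G ⧸ H} (hz : z ^ p = 1) : z = 1 :=
  quotient_pow_prime_eq_one_imp hp.out H
    (not_dvd_card_quotient_of_orderOf_eq H hyH (orderOf_eq_prime_pow_of_certificate hv hpow hnot) hG) hz

end Summit.BirchSwinnertonDyer.Rank1Residual.X11b.SClassCertificate

namespace Summit.BirchSwinnertonDyer.Rank1Residual.X11b.SClassCertificate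

/-! ## The non-cyclic case with two generators (all 32 non-cyclic tail classes have a 3-Sylow `ℤ/3^{v₁} × ℤ/3^{v₂}`) -/

/-- Socle independence of two commuting elements of `p`-power exponent keeps the second socle element out of the cyclic group of the
first: if `y₁^(p^v₁) = 1`, `y₂^(p^v₂) = 1` (`v₁, v₂ ≥ 1`) and `(y₁^(p^(v₁-1)))^a · (y₂^(p^(v₂-1)))^b = 1` with `a, b < p` only for
`a = b = 0`, then `y₂^(p^(v₂-1)) ∉ ⟨y₁⟩`. -/
theorem pow_not_mem_zpowers_of_socle_indep {G : Type*} [CommGroup G] {p : ℕ} [hp : Fact p.Prime] {y₁ y₂ : G} {v₁ v₂ : ℕ}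
    (hv₁ : 1 ≤ v₁) (hv₂ : 1 ≤ v₂) (h₁ : y₁ ^ (p ^ v₁) = 1) (h₂ : y₂ ^ (p ^ v₂) = 1)
    (hind : ∀ a b : ℕ, a < p → b < p → (y₁ ^ (p ^ (v₁ - 1))) ^ a * (y₂ ^ (p ^ (v₂ - 1))) ^ b = 1 → a = 0 ∧ b = 0) :
    y₂ ^ (p ^ (v₂ - 1)) ∉ Subgroup.zpowers y₁ := by
  intro hmem
  have hp1 : 1 < p := hp.out.one_lt
  have hp0 : 0 < p := hp.out.pos
  have hpz : (0 : ℤ) < p := by exact_mod_cast hp0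
  have hpne : (p : ℤ) ≠ 0 := ne_of_gt hpz
  obtain ⟨n, hn⟩ := Subgroup.mem_zpowers_iff.mp hmem
  have hz1p : (y₁ ^ (p ^ (v₁ - 1))) ^ p = 1 := by
    rw [← pow_mul, ← pow_succ, Nat.sub_add_cancel hv₁, h₁]
  -- (y₁^n)^p = y₂^(p^v₂) = 1
  have hnp : y₁ ^ (n * p) = 1 := by
    rw [zpow_mul, hn, zpow_natCast, ← pow_mul, ← pow_succ, Nat.sub_add_cancel hv₂, h₂]
  -- orderOf y₁ = p^v₁ exactly (independence with (a,b) = (1,0))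
  have hne : y₁ ^ (p ^ (v₁ - 1)) ≠ 1 := by
    intro h
    have := hind 1 0 hp1 hp0 (by rw [pow_one, pow_zero, mul_one, h])
    exact one_ne_zero this.1
  have hordeq : orderOf y₁ = p ^ v₁ := orderOf_eq_prime_pow_of_certificate hv₁ h₁ hne
  have hdvd : (orderOf y₁ : ℤ) ∣ n * p := orderOf_dvd_iff_zpow_eq_one.mpr hnp
  -- hence p^(v₁-1) ∣ n
  have key : ((p ^ (v₁ - 1) : ℕ) : ℤ) ∣ n := by
    rw [hordeq] at hdvd
    obtain ⟨w, rfl⟩ : ∃ w, v₁ = w + 1 := ⟨v₁ - 1, by omega⟩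
    simp only [Nat.add_sub_cancel]
    rw [pow_succ] at hdvd
    push_cast at hdvd ⊢
    exact (mul_dvd_mul_iff_right hpne).mp hdvd
  obtain ⟨m, hm⟩ := key
  -- y₂^(p^(v₂-1)) = z₁^m with z₁ := y₁^(p^(v₁-1)); reduce m mod p using z₁^p = 1
  have hz2 : y₂ ^ (p ^ (v₂ - 1)) = (y₁ ^ (p ^ (v₁ - 1))) ^ m := by
    rw [← hn, hm, zpow_mul, zpow_natCast]
  have hmod0 : 0 ≤ m % (p : ℤ) := Int.emod_nonneg m hpne
  have hmodp : m % (p : ℤ) < p := Int.emod_lt_of_pos m hpz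
  set r : ℕ := (m % (p : ℤ)).toNat with hr
  have hrz : (r : ℤ) = m % (p : ℤ) := by rw [hr, Int.toNat_of_nonneg hmod0]
  have hrp : r < p := by omega
  have hz1r : (y₁ ^ (p ^ (v₁ - 1))) ^ m = (y₁ ^ (p ^ (v₁ - 1))) ^ r := by
    rw [zpow_eq_zpow_emod' m hz1p, ← hrz, zpow_natCast]
  -- independence with a = (p - r) % p, b = 1 gives the contradiction
  have hfin : (y₁ ^ (p ^ (v₁ - 1))) ^ ((p - r) % p) * (y₂ ^ (p ^ (v₂ - 1))) ^ 1 = 1 := by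
    rw [pow_one, hz2, hz1r, ← pow_add]
    have hsum : p ∣ (p - r) % p + r := by
      rcases Nat.eq_zero_or_pos r with hr0 | hr0
      · rw [hr0]; simp
      · rw [Nat.mod_eq_of_lt (by omega : p - r < p), Nat.sub_add_cancel hrp.le]
    obtain ⟨c, hc⟩ := hsum
    rw [hc, pow_mul, hz1p, one_pow]
  have := hind ((p - r) % p) 1 (Nat.mod_lt _ hp0) hp1 hfin
  exact one_ne_zero this.2

/-- **Two-generator S-class certificate.** In a finite abelian group let `H` contain `y₁, y₂` with `y₁^(p^v₁) = y₂^(p^v₂) = 1`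
(`v₁, v₂ ≥ 1`) whose socle elements `y₁^(p^(v₁-1))`, `y₂^(p^(v₂-1))` are `𝔽_p`-independent, and suppose `p^(v₁+v₂+1) ∤ #G`.
Then `p^(v₁+v₂) ∣ #H` and the quotient `G ⧸ H` (`= Cl_S(A)`) has no element of order `p`. -/
theorem sclass_certificate₂ {G : Type*} [CommGroup G] [Finite G] {p v₁ v₂ : ℕ} [hp : Fact p.Prime] (H : Subgroup G) {y₁ y₂ : G}
    (hy₁ : y₁ ∈ H) (hy₂ : y₂ ∈ H) (hv₁ : 1 ≤ v₁) (hv₂ : 1 ≤ v₂) (h₁ : y₁ ^ (p ^ v₁) = 1) (h₂ : y₂ ^ (p ^ v₂) = 1)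
    (hind : ∀ a b : ℕ, a < p → b < p → (y₁ ^ (p ^ (v₁ - 1))) ^ a * (y₂ ^ (p ^ (v₂ - 1))) ^ b = 1 → a = 0 ∧ b = 0)
    (hG : ¬ p ^ (v₁ + v₂ + 1) ∣ Nat.card G) {z : G ⧸ H} (hz : z ^ p = 1) : z = 1 := by
  have hp1 : 1 < p := hp.out.one_lt
  have hp0 : 0 < p := hp.out.pos
  -- work inside H
  let a₁ : H := ⟨y₁, hy₁⟩
  let a₂ : H := ⟨y₂, hy₂⟩
  have ha₁ : a₁ ^ (p ^ v₁) = 1 := by apply Subtype.ext; simp [a₁, h₁]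
  have ha₂ : a₂ ^ (p ^ v₂) = 1 := by apply Subtype.ext; simp [a₂, h₂]
  have hindH : ∀ a b : ℕ, a < p → b < p → (a₁ ^ (p ^ (v₁ - 1))) ^ a * (a₂ ^ (p ^ (v₂ - 1))) ^ b = 1 → a = 0 ∧ b = 0 := by
    intro a b ha hb hab
    apply hind a b ha hb
    have := congrArg Subtype.val hab
    simpa [a₁, a₂] using this
  have hne₁ : a₁ ^ (p ^ (v₁ - 1)) ≠ 1 := by
    intro h; have := hindH 1 0 hp1 hp0 (by rw [pow_one, pow_zero, mul_one, h]); exact one_ne_zero this.1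
  have hord₁ : orderOf a₁ = p ^ v₁ := orderOf_eq_prime_pow_of_certificate hv₁ ha₁ hne₁
  let K : Subgroup H := Subgroup.zpowers a₁
  have hK : Nat.card K = p ^ v₁ := by rw [Nat.card_zpowers, hord₁]
  have hnotmem : a₂ ^ (p ^ (v₂ - 1)) ∉ K := pow_not_mem_zpowers_of_socle_indep hv₁ hv₂ ha₁ ha₂ hindH
  have hq1 : (QuotientGroup.mk a₂ : H ⧸ K) ^ (p ^ v₂) = 1 := by
    rw [← QuotientGroup.mk_pow, ha₂, QuotientGroup.mk_one]
  have hq2 : (QuotientGroup.mk a₂ : H ⧸ K) ^ (p ^ (v₂ - 1)) ≠ 1 := by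
    rw [← QuotientGroup.mk_pow, ne_eq, QuotientGroup.eq_one_iff]; exact hnotmem
  have hord₂ : orderOf (QuotientGroup.mk a₂ : H ⧸ K) = p ^ v₂ := orderOf_eq_prime_pow_of_certificate hv₂ hq1 hq2
  have hdvdQ : p ^ v₂ ∣ Nat.card (H ⧸ K) := by rw [← hord₂]; exact orderOf_dvd_natCard _
  have hcardH : p ^ (v₁ + v₂) ∣ Nat.card H := by
    rw [Subgroup.card_eq_card_quotient_mul_card_subgroup K, hK, pow_add, mul_comm]
    exact mul_dvd_mul hdvdQ dvd_rfl
  have hnd : ¬ p ∣ Nat.card (G ⧸ H) := by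
    intro hdiv
    apply hG
    have h2 : Nat.card G = Nat.card H * Nat.card (G ⧸ H) := by
      rw [mul_comm]; exact (Subgroup.card_eq_card_quotient_mul_card_subgroup H)
    rw [h2, pow_succ]
    exact mul_dvd_mul hcardH hdiv
  exact quotient_pow_prime_eq_one_imp hp.out H hnd hz

end Summit.BirchSwinnertonDyer.Rank1Residual.X11b.SClassCertificate
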